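import Mathlib.Probability.Kernel.Composition.MeasureComp
import Mathlib.Probability.Kernel.Invariance
import Literature.MathematicalPhysics.KineticTheory.ContactLangevinGas
import HarnessLib

/-!
# Matched-temperature invariance of the contact-Langevin collision kernels

Companion to `Literature/MathematicalPhysics/KineticTheory/ContactLangevinGas.lean` (definition
items `defn-ContactLangevinGas`, `defn-ContactLangevinGas-2`; routes `RoughSpheresKappaDial` /
`BryanRoughSphereDial` of `AtomisticToContinuum/HydrodynamicLimit`, crux
`ContactLangevinErgodicity`). That file defines the spin-marginalised Bryan–Pidduck contact rule
(Chapman–Cowling 1970, (11.2,7)) and its Markov kernels on pair velocities,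
`clTangentialKernel κ θb n` (Gaussian tangential contact kick) and `clKernel κ θb n` (elastic
reflection followed by the kick), and *asserts in prose* that the bath temperature `θb` is
"matched" to a Maxwellian pair law of temperature `θ` exactly when `θb = θ`, because the kick acts
on the tangential relative velocity as the Ornstein–Uhlenbeck (Mehler) step
`g_t ↦ (1-κ)(1+κ)⁻¹ g_t - 2√κ(1+κ)⁻¹ k × Σ`, `Σ ~ N(0, 2θb I₃)`, and `((1-κ)² + 4κ)/(1+κ)² = 1`.

This file PROVES the positive half of that assertion, which is what makes the hypothesis
"invariant under the Gaussian tangential contact-kick kernel at matched temperature" of the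
zero-friction form of `ContactLangevinErgodicity` non-vacuous (Gibbs states satisfy it):

* `clTangentialKernel_invariant_maxwellianPair`: for `0 ≤ κ`, `0 ≤ θ`, `n ≠ 0` and every drift
  `u`, the product Maxwellian law `M_{θ,u} ⊗ M_{θ,u}`, `M_{θ,u} = law of u + √θ ξ`,
  `ξ ~ N(0, I₃)` (`stdGaussian V3`), is `Kernel.Invariant` under `clTangentialKernel κ θ n`;
* `map_reflectVel_maxwellianPair`: the elastic reflection `reflectVel n` preserves
  `M_{θ,u} ⊗ M_{θ,u}` (every `n`, `θ`, `u`);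
* `clKernel_invariant_maxwellianPair`: hence `M_{θ,u} ⊗ M_{θ,u}` is invariant under the full
  collision kernel `clKernel κ θ n` (`clKernel_comp_eq_clTangentialKernel_comp_map`:
  `K ∘ μ = K_t ∘ (R_* μ)`);
* density form: `withDensity_localMaxwellian_eq_map_stdGaussian` identifies, for `θ > 0` and in
  any finite-dimensional inner product space, the unit-density local Maxwellian law
  `M_{1,u,θ}(v) dv` (`Literature.Analysis.FluidPDE.localMaxwellian`, the velocity factor of the
  hard-sphere Gibbs states, `maxwellianBeta β (v - u) = localMaxwellian 1 β⁻¹ 0 (v - u)`) with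
  `M_{θ,u}`, whence `clTangentialKernel_invariant_localMaxwellianPair` and
  `clKernel_invariant_localMaxwellianPair`.

Method (no densities): `K_t ∘ μ` is the image of `μ ⊗ N(0, I₃)` under the kick
(`clTangentialKernel_comp_eq_map`); in the variables `vᵢ = u + √θ x`, `vⱼ = u + √θ y` the kick is
an affine map `A(x, y, ξ) + (u, u)` with `A` continuous linear (`exists_clm_clTangentialKick`), so
both sides are affine images of products of standard Gaussians and are compared through their
characteristic functionals (`charFunDual_map`, `charFunDual_prod`, `charFunDual_stdGaussian`,
`Measure.ext_of_charFunDual`): equality reduces to the identity of variance functionals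
`∑ᵢ ‖L ∘ A ∘ ιᵢ‖² = θ(‖L ∘ ι₁‖² + ‖L ∘ ι₂‖²)` for all `L` (`map_stdGaussian₃_eq_map_stdGaussian₂`),
which after Riesz representation `L(y, z) = ⟪a, y⟫ + ⟪b, z⟫` is the Euclidean identity
`‖a - cPε‖² + ‖b + cPε‖² + 2s²‖ε × k‖² = ‖a‖² + ‖b‖²`, `ε = a - b`, `Pε = ε - ⟪ε,k⟫k`,
`c = κ/(1+κ)`, `s² = κ/(1+κ)²`, `‖k‖ = 1` — i.e. the fluctuation–dissipation identity
`s² = c(1 - c)` (`clTangentialKick_variance_identity`).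

Remark (recorded for the planners of the zero-friction form; not used below). The leading-order
truncation `J_t = -√κ k × Σ - κ g_t` of the tangential impulse does NOT preserve `M_θ ⊗ M_θ` at
`θb = θ`: its variance factor is `(1-2κ)² + 4κ = 1 + 4κ² ≠ 1`. State invariance hypotheses with
the exact kernel `clTangentialKernel κ θ n` (any `κ > 0`), as the definition file does.

## References

* S. Chapman, T. G. Cowling, *The Mathematical Theory of Non-uniform Gases*, 3rd ed., CUP 1970,
  §11.2, eq. (11.2,7) (Bryan's rough-sphere collision rule; the spin-marginalised form is the
  definition file's `clTangentialImpulse`).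
* The Gaussian computation itself is folklore (invariance of `N(0, θ)` under an AR(1)/Mehler step
  with matched noise); Mathlib: `ProbabilityTheory.charFunDual_stdGaussian`,
  `MeasureTheory.Measure.ext_of_charFunDual`.
-/

noncomputable section

open MeasureTheory ProbabilityTheory Matrix WithLp Complex
open Literature.Analysis.FluidPDE
open scoped ENNReal RealInnerProductSpace

namespace Literature.MathematicalPhysics.KineticTheory

/-! ### Gaussian engine: linear images of independent standard Gaussians -/

/-- If two affine images `A(ξ₁, ξ₂, ξ₃) + r` and `B(ξ₁, ξ₂) + r` of independent standard Gaussians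
on `ℝ³` have, for every linear functional `L` on `ℝ³ × ℝ³`, the same variance
`∑ᵢ ‖L ∘ A ∘ ιᵢ‖² = ∑ⱼ ‖L ∘ B ∘ ιⱼ‖²`, then they have the same law (both are Gaussian; comparison
of characteristic functionals). [folklore] -/
theorem map_stdGaussian₃_eq_map_stdGaussian₂ {A : (V3 × V3) × V3 →L[ℝ] V3 × V3}
    {B : V3 × V3 →L[ℝ] V3 × V3}
    (h : ∀ L : StrongDual ℝ (V3 × V3),
      ‖((L.comp A).comp (.inl ℝ (V3 × V3) V3)).comp (.inl ℝ V3 V3)‖ ^ 2 +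
        ‖((L.comp A).comp (.inl ℝ (V3 × V3) V3)).comp (.inr ℝ V3 V3)‖ ^ 2 +
        ‖(L.comp A).comp (.inr ℝ (V3 × V3) V3)‖ ^ 2 =
      ‖(L.comp B).comp (.inl ℝ V3 V3)‖ ^ 2 + ‖(L.comp B).comp (.inr ℝ V3 V3)‖ ^ 2)
    (r : V3 × V3) :
    (((stdGaussian V3).prod (stdGaussian V3)).prod (stdGaussian V3)).map (fun q => A q + r) =
      ((stdGaussian V3).prod (stdGaussian V3)).map (fun p => B p + r) := by
  have hA : (fun q => A q + r) = (· + r) ∘ A := rfl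
  have hB : (fun p => B p + r) = (· + r) ∘ B := rfl
  rw [hA, hB, ← Measure.map_map (measurable_add_const r) A.continuous.measurable,
    ← Measure.map_map (measurable_add_const r) B.continuous.measurable]
  apply Measure.ext_of_charFunDual
  ext L
  rw [charFunDual_map_add_const, charFunDual_map_add_const, charFunDual_map, charFunDual_map,
    charFunDual_prod, charFunDual_prod, charFunDual_prod, charFunDual_stdGaussian,
    charFunDual_stdGaussian, charFunDual_stdGaussian, charFunDual_stdGaussian,
    charFunDual_stdGaussian]
  simp only [← Complex.exp_add]
  congr 1
  have := congrArg (fun x : ℝ => (-(x : ℂ)) / 2) (h L)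
  push_cast at this ⊢
  linear_combination this

/-! ### The kernels as push-forwards -/

/-- `K_t ∘ μ` is the image of `μ ⊗ N(0, I₃)` under the tangential kick. [folklore] -/
theorem clTangentialKernel_comp_eq_map (κ θb : ℝ) (n : V3) (μ : Measure (V3 × V3))
    [SFinite μ] :
    clTangentialKernel κ θb n ∘ₘ μ =
      (μ.prod (stdGaussian V3)).map (fun q => clTangentialKick κ θb n q.1 q.2) := by
  rw [clTangentialKernel, ← Measure.map_comp _ _ (measurable_clTangentialKick κ θb n),
    ← Measure.compProd_eq_comp_prod, Measure.compProd_const]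

/-- `K ∘ μ` is the image of `μ ⊗ N(0, I₃)` under the full kick. [folklore] -/
theorem clKernel_comp_eq_map (κ θb : ℝ) (n : V3) (μ : Measure (V3 × V3)) [SFinite μ] :
    clKernel κ θb n ∘ₘ μ =
      (μ.prod (stdGaussian V3)).map (fun q => clKick κ θb n q.1 q.2) := by
  rw [clKernel, ← Measure.map_comp _ _ (measurable_clKick κ θb n),
    ← Measure.compProd_eq_comp_prod, Measure.compProd_const]

/-- Dual norm through a Riesz representative. [folklore] -/
theorem norm_dual_eq_norm_of_inner {L : StrongDual ℝ V3} {v : V3} (h : ∀ x, L x = ⟪v, x⟫) :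
    ‖L‖ = ‖v‖ := by
  have : L = InnerProductSpace.toDual ℝ V3 v := by
    ext x
    rw [InnerProductSpace.toDual_apply_apply, h x]
  rw [this, LinearIsometryEquiv.norm_map]


/-! ### Euclidean cross-product bookkeeping on `V3 = EuclideanSpace ℝ (Fin 3)` -/

/-- Scalar triple product, Euclidean form: `⟪a, k × ξ⟫ = ⟪a × k, ξ⟫`. [folklore] -/
theorem inner_crossE_right (a k ξ : V3) :
    ⟪a, toLp 2 (ofLp k ⨯₃ ofLp ξ)⟫ = ⟪toLp 2 (ofLp a ⨯₃ ofLp k), ξ⟫ := by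
  rw [EuclideanSpace.inner_eq_star_dotProduct, EuclideanSpace.inner_eq_star_dotProduct,
    star_trivial, star_trivial, ofLp_toLp, ofLp_toLp, dotProduct_comm (ofLp k ⨯₃ ofLp ξ),
    triple_product_permutation, triple_product_permutation, dotProduct_comm]

/-- Lagrange's identity, Euclidean form: `‖a × k‖² = ‖a‖² ‖k‖² - ⟪a, k⟫²`. [folklore] -/
theorem norm_sq_crossE (a k : V3) :
    ‖toLp 2 (ofLp a ⨯₃ ofLp k)‖ ^ 2 = ‖a‖ ^ 2 * ‖k‖ ^ 2 - ⟪a, k⟫ ^ 2 := by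
  rw [← real_inner_self_eq_norm_sq, ← real_inner_self_eq_norm_sq, ← real_inner_self_eq_norm_sq,
    EuclideanSpace.inner_toLp_toLp, star_trivial, cross_dot_cross,
    EuclideanSpace.inner_eq_star_dotProduct, EuclideanSpace.inner_eq_star_dotProduct,
    EuclideanSpace.inner_eq_star_dotProduct]
  simp only [star_trivial, dotProduct_comm (ofLp a) (ofLp k)]
  ring

/-! ### The tangential kick is affine in (velocities, noise) -/

/-- The tangential kick, read in the variables `(x, y, ξ)` of `vᵢ = u + √θ x`, `vⱼ = u + √θ y`,
is a continuous linear map of `((x, y), ξ)` up to the constant drift `(u, u)`. [folklore] -/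
theorem exists_clm_clTangentialKick (κ θb θ : ℝ) (n u : V3) :
    ∃ A : (V3 × V3) × V3 →L[ℝ] V3 × V3, ∀ x y ξ,
      A ((x, y), ξ) =
        clTangentialKick κ θb n (u + Real.sqrt θ • x, u + Real.sqrt θ • y) ξ - (u, u) := by
  obtain ⟨k, hk⟩ : ∃ k : V3, k = ‖n‖⁻¹ • n := ⟨_, rfl⟩
  let P : V3 →L[ℝ] V3 := ContinuousLinearMap.id ℝ V3 - (innerSL ℝ k).smulRight k
  let Cx : V3 →L[ℝ] V3 :=
    (EuclideanSpace.equiv (Fin 3) ℝ).symm.toContinuousLinearMap.comp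
      ((LinearMap.toContinuousLinearMap (crossProduct (ofLp k))).comp
        (EuclideanSpace.equiv (Fin 3) ℝ).toContinuousLinearMap)
  let π₁ : (V3 × V3) × V3 →L[ℝ] V3 :=
    (ContinuousLinearMap.fst ℝ V3 V3).comp (ContinuousLinearMap.fst ℝ (V3 × V3) V3)
  let π₂ : (V3 × V3) × V3 →L[ℝ] V3 :=
    (ContinuousLinearMap.snd ℝ V3 V3).comp (ContinuousLinearMap.fst ℝ (V3 × V3) V3)
  let π₃ : (V3 × V3) × V3 →L[ℝ] V3 := ContinuousLinearMap.snd ℝ (V3 × V3) V3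
  let T : (V3 × V3) × V3 →L[ℝ] V3 :=
    -((κ / (1 + κ) * Real.sqrt θ) • P.comp (π₁ - π₂)) -
      (Real.sqrt κ / (1 + κ) * Real.sqrt (2 * θb)) • Cx.comp π₃
  refine ⟨(Real.sqrt θ • π₁ + T).prod (Real.sqrt θ • π₂ - T), fun x y ξ => ?_⟩
  have hg : u + Real.sqrt θ • x - (u + Real.sqrt θ • y) = Real.sqrt θ • (x - y) := by
    rw [smul_sub]; abel
  have hT : T ((x, y), ξ) =
      clTangentialImpulse κ θb n (u + Real.sqrt θ • x - (u + Real.sqrt θ • y)) ξ := by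
    change -((κ / (1 + κ) * Real.sqrt θ) • ((x - y) - ⟪k, x - y⟫ • k)) -
        (Real.sqrt κ / (1 + κ) * Real.sqrt (2 * θb)) • toLp 2 (ofLp k ⨯₃ ofLp ξ) = _
    rw [hg, clTangentialImpulse, ← hk, real_inner_smul_left, real_inner_comm k]
    module
  change (Real.sqrt θ • x + T ((x, y), ξ), Real.sqrt θ • y - T ((x, y), ξ)) = _
  rw [hT]
  simp only [clTangentialKick, Prod.mk_sub_mk, Prod.mk.injEq]
  constructor <;> abel

/-! ### The variance identity at matched temperature -/

/-- For the affine representation `A` of the tangential kick at bath temperature `θb = θ` and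
`B = √θ · id`, the variance functionals of `A(ξ₁, ξ₂, ξ₃)` and `B(ξ₁, ξ₂)` agree for every
linear functional `L`: this is the fluctuation–dissipation identity `κ/(1+κ)² = c(1-c)`,
`c = κ/(1+κ)`, i.e. `((1-κ)² + 4κ)/(1+κ)² = 1`. [folklore] -/
theorem clTangentialKick_variance_identity {κ θ : ℝ} (hκ : 0 ≤ κ) (hθ : 0 ≤ θ) {n : V3}
    (hn : n ≠ 0) (u : V3) {A : (V3 × V3) × V3 →L[ℝ] V3 × V3}
    (hA : ∀ x y ξ, A ((x, y), ξ) =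
      clTangentialKick κ θ n (u + Real.sqrt θ • x, u + Real.sqrt θ • y) ξ - (u, u))
    (L : StrongDual ℝ (V3 × V3)) :
    ‖((L.comp A).comp (.inl ℝ (V3 × V3) V3)).comp (.inl ℝ V3 V3)‖ ^ 2 +
        ‖((L.comp A).comp (.inl ℝ (V3 × V3) V3)).comp (.inr ℝ V3 V3)‖ ^ 2 +
        ‖(L.comp A).comp (.inr ℝ (V3 × V3) V3)‖ ^ 2 =
      ‖(L.comp (Real.sqrt θ • ContinuousLinearMap.id ℝ (V3 × V3))).comp (.inl ℝ V3 V3)‖ ^ 2 +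
        ‖(L.comp (Real.sqrt θ • ContinuousLinearMap.id ℝ (V3 × V3))).comp (.inr ℝ V3 V3)‖ ^ 2 := by
  obtain ⟨k, hk⟩ : ∃ k : V3, k = ‖n‖⁻¹ • n := ⟨_, rfl⟩
  have hk1 : ‖k‖ = 1 := by
    rw [hk, norm_smul, norm_inv, norm_norm, inv_mul_cancel₀ (norm_ne_zero_iff.2 hn)]
  obtain ⟨a, ha⟩ : ∃ a : V3, a = (InnerProductSpace.toDual ℝ V3).symm (L.comp (.inl ℝ V3 V3)) :=
    ⟨_, rfl⟩
  obtain ⟨b, hb⟩ : ∃ b : V3, b = (InnerProductSpace.toDual ℝ V3).symm (L.comp (.inr ℝ V3 V3)) :=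
    ⟨_, rfl⟩
  have hL : ∀ y z : V3, L (y, z) = ⟪a, y⟫ + ⟪b, z⟫ := by
    intro y z
    rw [ha, hb, InnerProductSpace.toDual_symm_apply, InnerProductSpace.toDual_symm_apply,
      ContinuousLinearMap.comp_apply, ContinuousLinearMap.comp_apply,
      ContinuousLinearMap.inl_apply, ContinuousLinearMap.inr_apply, ← map_add, Prod.mk_add_mk,
      add_zero, zero_add]
  obtain ⟨c, hc⟩ : ∃ c : ℝ, c = κ / (1 + κ) := ⟨_, rfl⟩
  obtain ⟨s, hs⟩ : ∃ s : ℝ, s = Real.sqrt κ / (1 + κ) * Real.sqrt (2 * θ) := ⟨_, rfl⟩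
  obtain ⟨t, ht⟩ : ∃ t : ℝ, t = Real.sqrt θ := ⟨_, rfl⟩
  have hJ : ∀ g ξ : V3, clTangentialImpulse κ θ n g ξ =
      -(c • (g - ⟪g, k⟫ • k)) - s • toLp 2 (ofLp k ⨯₃ ofLp ξ) := by
    intro g ξ
    rw [clTangentialImpulse, ← hk, hc, hs]
  have v1 : ∀ v J : V3, u + v + J - u = v + J := fun v J => by abel
  have v2 : ∀ v J : V3, u + v - J - u = v - J := fun v J => by abel
  have v3 : ∀ J : V3, u - J - u = -J := fun J => by abel
  rw [← ht] at hA
  -- the five functionals through their Riesz vectors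
  have e1 : ∀ x : V3, (((L.comp A).comp (.inl ℝ (V3 × V3) V3)).comp (.inl ℝ V3 V3)) x =
      ⟪t • (a - c • ((a - b) - ⟪a - b, k⟫ • k)), x⟫ := by
    intro x
    simp only [ContinuousLinearMap.comp_apply, ContinuousLinearMap.inl_apply]
    rw [hA, clTangentialKick]
    simp only [smul_zero, add_zero, add_sub_cancel_left, hJ, ofLp_zero, map_zero, toLp_zero,
      sub_zero, Prod.mk_sub_mk, v1, v3, hL]
    simp only [inner_add_right, inner_sub_left, inner_sub_right, inner_neg_right,
      real_inner_smul_left, real_inner_smul_right, real_inner_comm x k]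
    ring
  have e2 : ∀ y : V3, (((L.comp A).comp (.inl ℝ (V3 × V3) V3)).comp (.inr ℝ V3 V3)) y =
      ⟪t • (b + c • ((a - b) - ⟪a - b, k⟫ • k)), y⟫ := by
    intro y
    simp only [ContinuousLinearMap.comp_apply, ContinuousLinearMap.inl_apply,
      ContinuousLinearMap.inr_apply]
    rw [hA, clTangentialKick]
    simp only [smul_zero, add_zero, sub_add_cancel_left, hJ, ofLp_zero, map_zero, toLp_zero,
      smul_zero, sub_zero, Prod.mk_sub_mk, add_sub_cancel_left, v2, hL]
    simp only [inner_add_left, inner_sub_left, inner_sub_right, inner_neg_right, inner_neg_left,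
      real_inner_smul_left, real_inner_smul_right, real_inner_comm y k]
    ring
  have e3 : ∀ ξ : V3, ((L.comp A).comp (.inr ℝ (V3 × V3) V3)) ξ =
      ⟪(-s) • toLp 2 (ofLp (a - b) ⨯₃ ofLp k), ξ⟫ := by
    intro ξ
    simp only [ContinuousLinearMap.comp_apply, ContinuousLinearMap.inr_apply]
    rw [show (0 : V3 × V3) = (0, 0) from rfl, hA, clTangentialKick]
    simp only [smul_zero, add_zero, sub_self, hJ, inner_zero_left, zero_smul, smul_zero,
      neg_zero, zero_sub, Prod.mk_sub_mk, add_sub_cancel_left, v3, neg_neg, hL]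
    rw [inner_neg_right, inner_smul_right, inner_smul_right, inner_crossE_right,
      inner_crossE_right, real_inner_smul_left, ofLp_sub, LinearMap.map_sub₂, toLp_sub,
      inner_sub_left]
    ring
  have f1 : ∀ x : V3,
      ((L.comp (t • ContinuousLinearMap.id ℝ (V3 × V3))).comp (.inl ℝ V3 V3)) x = ⟪t • a, x⟫ := by
    intro x
    change L (t • x, t • (0 : V3)) = _
    rw [smul_zero, hL, inner_zero_right, add_zero, real_inner_smul_left, real_inner_smul_right]
  have f2 : ∀ y : V3,
      ((L.comp (t • ContinuousLinearMap.id ℝ (V3 × V3))).comp (.inr ℝ V3 V3)) y = ⟪t • b, y⟫ := by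
    intro y
    change L (t • (0 : V3), t • y) = _
    rw [smul_zero, hL, inner_zero_right, zero_add, real_inner_smul_left, real_inner_smul_right]
  rw [← ht, norm_dual_eq_norm_of_inner e1, norm_dual_eq_norm_of_inner e2,
    norm_dual_eq_norm_of_inner e3, norm_dual_eq_norm_of_inner f1, norm_dual_eq_norm_of_inner f2]
  -- scalar bookkeeping
  set ε : V3 := a - b with hε
  set Pε : V3 := ε - ⟪ε, k⟫ • k with hPε
  have hPa : ⟪a, Pε⟫ - ⟪b, Pε⟫ = ‖ε‖ ^ 2 - ⟪ε, k⟫ ^ 2 := by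
    rw [← inner_sub_left, ← hε, hPε, inner_sub_right, inner_smul_right,
      real_inner_self_eq_norm_sq]
    ring
  have hPP : ‖Pε‖ ^ 2 = ‖ε‖ ^ 2 - ⟪ε, k⟫ ^ 2 := by
    rw [hPε, norm_sub_sq_real, inner_smul_right, norm_smul, hk1, Real.norm_eq_abs, mul_one,
      sq_abs]
    ring
  have hX : ‖toLp 2 (ofLp ε ⨯₃ ofLp k)‖ ^ 2 = ‖ε‖ ^ 2 - ⟪ε, k⟫ ^ 2 := by
    rw [norm_sq_crossE, hk1]
    ring
  have h1κ : (1 + κ) ≠ 0 := by positivity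
  have hss : s ^ 2 = 2 * θ * (c - c ^ 2) := by
    rw [hs, hc, mul_pow, div_pow, Real.sq_sqrt hκ, Real.sq_sqrt (by positivity)]
    field_simp
    ring
  have htt : t ^ 2 = θ := by rw [ht, Real.sq_sqrt hθ]
  have E1 : ‖t • (a - c • Pε)‖ ^ 2 = t ^ 2 * (‖a‖ ^ 2 - 2 * c * ⟪a, Pε⟫ + c ^ 2 * ‖Pε‖ ^ 2) := by
    rw [norm_smul, mul_pow, Real.norm_eq_abs, sq_abs, norm_sub_sq_real, inner_smul_right,
      norm_smul, mul_pow, Real.norm_eq_abs, sq_abs]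
    ring
  have E2 : ‖t • (b + c • Pε)‖ ^ 2 = t ^ 2 * (‖b‖ ^ 2 + 2 * c * ⟪b, Pε⟫ + c ^ 2 * ‖Pε‖ ^ 2) := by
    rw [norm_smul, mul_pow, Real.norm_eq_abs, sq_abs, norm_add_sq_real, inner_smul_right,
      norm_smul, mul_pow, Real.norm_eq_abs, sq_abs]
    ring
  have E3 : ‖(-s) • toLp 2 (ofLp ε ⨯₃ ofLp k)‖ ^ 2 = s ^ 2 * ‖toLp 2 (ofLp ε ⨯₃ ofLp k)‖ ^ 2 := by
    rw [norm_smul, mul_pow, Real.norm_eq_abs, sq_abs, neg_sq]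
  have E4 : ‖t • a‖ ^ 2 = t ^ 2 * ‖a‖ ^ 2 := by
    rw [norm_smul, mul_pow, Real.norm_eq_abs, sq_abs]
  have E5 : ‖t • b‖ ^ 2 = t ^ 2 * ‖b‖ ^ 2 := by
    rw [norm_smul, mul_pow, Real.norm_eq_abs, sq_abs]
  rw [E1, E2, E3, E4, E5, hPP, hX, htt, hss]
  linear_combination (-2 * θ * c) * hPa

/-! ### Matched-temperature invariance -/

/-- Product with an unchanged factor as an image of the product. [folklore] -/
theorem map_prod_eq_map_prodMap_id {α β γ : Type*} [MeasurableSpace α] [MeasurableSpace β]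
    [MeasurableSpace γ] (μ : Measure α) (ν : Measure γ) [SFinite μ] [SFinite ν] {f : α → β}
    (hf : Measurable f) : (μ.map f).prod ν = (μ.prod ν).map (Prod.map f id) := by
  simpa using Measure.map_prod_map μ ν hf measurable_id

/-- **Matched-temperature invariance of the Gaussian tangential contact kick** (pair-level
fluctuation–dissipation balance of the spin bath). For roughness `κ ≥ 0`, temperature `θ ≥ 0`,
contact normal `n ≠ 0` and any common drift `u`, the law `M_{θ,u} ⊗ M_{θ,u}` of two independent
Maxwellian velocities of temperature `θ` and mean `u` (unit mass; `M_{θ,u}` = law of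
`u + √θ ξ`, `ξ ~ N(0, I₃)`) is invariant under the tangential contact-kick kernel
`clTangentialKernel κ θ n` whose bath temperature EQUALS `θ`: in relative/centre-of-mass
variables the kick is `V ↦ V`, `g_n ↦ g_n`, `g_t ↦ (1-κ)(1+κ)⁻¹ g_t - 2√κ(1+κ)⁻¹ k × Σ`,
`Σ ~ N(0, 2θ I₃)`, an exact Ornstein–Uhlenbeck (Mehler) step since
`((1-κ)² + 4κ)/(1+κ)² = 1` (Chapman–Cowling 1970 (11.2,7) with the pair spin drawn from its
Gibbs marginal at temperature `θ`). This is the non-vacuity of the hypothesis "invariant under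
the Gaussian tangential contact-kick kernel at matched temperature" in the zero-friction form of
`ContactLangevinErgodicity`: Gibbs states satisfy it. The collision rule is Chapman–Cowling's
[cite: ChapmanCowling1970, §11.2 eq. 7]; the invariance is a direct Gaussian computation.
[folklore] -/
theorem clTangentialKernel_invariant_maxwellianPair {κ θ : ℝ} (hκ : 0 ≤ κ) (hθ : 0 ≤ θ) {n : V3}
    (hn : n ≠ 0) (u : V3) :
    Kernel.Invariant (clTangentialKernel κ θ n)
      (((stdGaussian V3).map (fun ξ => u + Real.sqrt θ • ξ)).prod
        ((stdGaussian V3).map (fun ξ => u + Real.sqrt θ • ξ))) := by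
  obtain ⟨A, hA⟩ := exists_clm_clTangentialKick κ θ θ n u
  have hf : Measurable (fun ξ : V3 => u + Real.sqrt θ • ξ) := by fun_prop
  have hMM : ((stdGaussian V3).map (fun ξ => u + Real.sqrt θ • ξ)).prod
        ((stdGaussian V3).map (fun ξ => u + Real.sqrt θ • ξ)) =
      ((stdGaussian V3).prod (stdGaussian V3)).map
        (fun p => (Real.sqrt θ • ContinuousLinearMap.id ℝ (V3 × V3)) p + (u, u)) := by
    rw [Measure.map_prod_map _ _ hf hf]
    congr 1
    funext p
    obtain ⟨x, y⟩ := p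
    change (u + Real.sqrt θ • x, u + Real.sqrt θ • y) = (Real.sqrt θ • x, Real.sqrt θ • y) + (u, u)
    rw [Prod.mk_add_mk, add_comm u, add_comm u]
  have hK : clTangentialKernel κ θ n ∘ₘ
        (((stdGaussian V3).map (fun ξ => u + Real.sqrt θ • ξ)).prod
          ((stdGaussian V3).map (fun ξ => u + Real.sqrt θ • ξ))) =
      (((stdGaussian V3).prod (stdGaussian V3)).prod (stdGaussian V3)).map
        (fun q => A q + (u, u)) := by
    rw [clTangentialKernel_comp_eq_map, Measure.map_prod_map _ _ hf hf,
      map_prod_eq_map_prodMap_id _ _ (hf.prodMap hf),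
      Measure.map_map (measurable_clTangentialKick κ θ n) ((hf.prodMap hf).prodMap measurable_id)]
    congr 1
    funext q
    obtain ⟨⟨x, y⟩, ξ⟩ := q
    simp [Prod.map, hA]
  rw [Kernel.Invariant, hK, hMM]
  exact map_stdGaussian₃_eq_map_stdGaussian₂ (clTangentialKick_variance_identity hκ hθ hn u hA)
    (u, u)

/-! ### The elastic reflection and the full collision kernel -/

/-- Two-factor version of `map_stdGaussian₃_eq_map_stdGaussian₂`: affine images of
`N(0, I₃) ⊗ N(0, I₃)` with equal variance functionals coincide. [folklore] -/
theorem map_stdGaussian₂_eq_map_stdGaussian₂ {A B : V3 × V3 →L[ℝ] V3 × V3}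
    (h : ∀ L : StrongDual ℝ (V3 × V3),
      ‖(L.comp A).comp (.inl ℝ V3 V3)‖ ^ 2 + ‖(L.comp A).comp (.inr ℝ V3 V3)‖ ^ 2 =
        ‖(L.comp B).comp (.inl ℝ V3 V3)‖ ^ 2 + ‖(L.comp B).comp (.inr ℝ V3 V3)‖ ^ 2)
    (r : V3 × V3) :
    ((stdGaussian V3).prod (stdGaussian V3)).map (fun p => A p + r) =
      ((stdGaussian V3).prod (stdGaussian V3)).map (fun p => B p + r) := by
  have hA : (fun p => A p + r) = (· + r) ∘ A := rfl
  have hB : (fun p => B p + r) = (· + r) ∘ B := rfl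
  rw [hA, hB, ← Measure.map_map (measurable_add_const r) A.continuous.measurable,
    ← Measure.map_map (measurable_add_const r) B.continuous.measurable]
  apply Measure.ext_of_charFunDual
  ext L
  rw [charFunDual_map_add_const, charFunDual_map_add_const, charFunDual_map, charFunDual_map,
    charFunDual_prod, charFunDual_prod, charFunDual_stdGaussian, charFunDual_stdGaussian,
    charFunDual_stdGaussian, charFunDual_stdGaussian]
  simp only [← Complex.exp_add]
  congr 1
  have := congrArg (fun x : ℝ => (-(x : ℂ)) / 2) (h L)
  push_cast at this ⊢
  linear_combination this

/-- The elastic reflection is continuous in the pair of velocities. [folklore] -/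
theorem continuous_reflectVel (n : V3) : Continuous (reflectVel n : V3 × V3 → V3 × V3) := by
  unfold reflectVel
  fun_prop

/-- The elastic reflection, read in the variables `(x, y)` of `vᵢ = u + √θ x`, `vⱼ = u + √θ y`,
is linear up to the constant drift `(u, u)`. [folklore] -/
theorem exists_clm_reflectVel (θ : ℝ) (n u : V3) :
    ∃ A : V3 × V3 →L[ℝ] V3 × V3, ∀ x y,
      A (x, y) = reflectVel n (u + Real.sqrt θ • x, u + Real.sqrt θ • y) - (u, u) := by
  let Λ : V3 × V3 →L[ℝ] ℝ :=
    (‖n‖ ^ 2)⁻¹ • (innerSL ℝ n).comp (ContinuousLinearMap.fst ℝ V3 V3 - ContinuousLinearMap.snd ℝ V3 V3)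
  refine ⟨Real.sqrt θ • ((ContinuousLinearMap.fst ℝ V3 V3 - Λ.smulRight n).prod
    (ContinuousLinearMap.snd ℝ V3 V3 + Λ.smulRight n)), fun x y => ?_⟩
  have hg : u + Real.sqrt θ • x - (u + Real.sqrt θ • y) = Real.sqrt θ • (x - y) := by
    rw [smul_sub]; abel
  change Real.sqrt θ • (x - ((‖n‖ ^ 2)⁻¹ * ⟪n, x - y⟫) • n, y + ((‖n‖ ^ 2)⁻¹ * ⟪n, x - y⟫) • n) = _
  simp only [reflectVel, hg, Prod.smul_mk, Prod.mk_sub_mk, real_inner_smul_right,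
    real_inner_comm n, Prod.mk.injEq]
  constructor <;> module

/-- Variance identity for the reflection: `‖a - λn‖² + ‖b + λn‖² = ‖a‖² + ‖b‖²` with
`λ = ⟪a - b, n⟫/‖n‖²` (the reflection is an isometry of `ℝ³ ⊕ ℝ³`). [folklore] -/
theorem reflectVel_variance_identity (θ : ℝ) {n : V3} (hn : n ≠ 0) (u : V3)
    {A : V3 × V3 →L[ℝ] V3 × V3}
    (hA : ∀ x y, A (x, y) = reflectVel n (u + Real.sqrt θ • x, u + Real.sqrt θ • y) - (u, u))
    (L : StrongDual ℝ (V3 × V3)) :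
    ‖(L.comp A).comp (.inl ℝ V3 V3)‖ ^ 2 + ‖(L.comp A).comp (.inr ℝ V3 V3)‖ ^ 2 =
      ‖(L.comp (Real.sqrt θ • ContinuousLinearMap.id ℝ (V3 × V3))).comp (.inl ℝ V3 V3)‖ ^ 2 +
        ‖(L.comp (Real.sqrt θ • ContinuousLinearMap.id ℝ (V3 × V3))).comp (.inr ℝ V3 V3)‖ ^ 2 := by
  obtain ⟨a, ha⟩ : ∃ a : V3, a = (InnerProductSpace.toDual ℝ V3).symm (L.comp (.inl ℝ V3 V3)) :=
    ⟨_, rfl⟩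
  obtain ⟨b, hb⟩ : ∃ b : V3, b = (InnerProductSpace.toDual ℝ V3).symm (L.comp (.inr ℝ V3 V3)) :=
    ⟨_, rfl⟩
  have hL : ∀ y z : V3, L (y, z) = ⟪a, y⟫ + ⟪b, z⟫ := by
    intro y z
    rw [ha, hb, InnerProductSpace.toDual_symm_apply, InnerProductSpace.toDual_symm_apply,
      ContinuousLinearMap.comp_apply, ContinuousLinearMap.comp_apply,
      ContinuousLinearMap.inl_apply, ContinuousLinearMap.inr_apply, ← map_add, Prod.mk_add_mk,
      add_zero, zero_add]
  obtain ⟨t, ht⟩ : ∃ t : ℝ, t = Real.sqrt θ := ⟨_, rfl⟩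
  obtain ⟨l, hl⟩ : ∃ l : ℝ, l = ⟪a - b, n⟫ / ‖n‖ ^ 2 := ⟨_, rfl⟩
  rw [← ht] at hA
  have hR : ∀ v w : V3, reflectVel n (u + t • v, u + t • w) - (u, u) =
      (t • v - (t * (⟪v - w, n⟫ / ‖n‖ ^ 2)) • n, t • w + (t * (⟪v - w, n⟫ / ‖n‖ ^ 2)) • n) := by
    intro v w
    have hg : u + t • v - (u + t • w) = t • (v - w) := by rw [smul_sub]; abel
    simp only [reflectVel, hg, real_inner_smul_left, Prod.mk_sub_mk, Prod.mk.injEq]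
    constructor
    · rw [mul_div_assoc]; abel
    · rw [mul_div_assoc]; abel
  have e1 : ∀ x : V3, ((L.comp A).comp (.inl ℝ V3 V3)) x = ⟪t • (a - l • n), x⟫ := by
    intro x
    simp only [ContinuousLinearMap.comp_apply, ContinuousLinearMap.inl_apply]
    rw [hA, hR, hL, sub_zero, hl]
    simp only [inner_sub_left, inner_sub_right, inner_add_right, real_inner_smul_left,
      real_inner_smul_right, real_inner_comm x n, smul_zero, inner_zero_right]
    ring
  have e2 : ∀ y : V3, ((L.comp A).comp (.inr ℝ V3 V3)) y = ⟪t • (b + l • n), y⟫ := by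
    intro y
    simp only [ContinuousLinearMap.comp_apply, ContinuousLinearMap.inr_apply]
    rw [hA, hR, hL, zero_sub, hl]
    simp only [inner_sub_left, inner_sub_right, inner_add_right, inner_add_left, inner_neg_left,
      real_inner_smul_left, real_inner_smul_right, real_inner_comm y n, smul_zero, inner_zero_right]
    ring
  have f1 : ∀ x : V3,
      ((L.comp (t • ContinuousLinearMap.id ℝ (V3 × V3))).comp (.inl ℝ V3 V3)) x = ⟪t • a, x⟫ := by
    intro x
    change L (t • x, t • (0 : V3)) = _
    rw [smul_zero, hL, inner_zero_right, add_zero, real_inner_smul_left, real_inner_smul_right]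
  have f2 : ∀ y : V3,
      ((L.comp (t • ContinuousLinearMap.id ℝ (V3 × V3))).comp (.inr ℝ V3 V3)) y = ⟪t • b, y⟫ := by
    intro y
    change L (t • (0 : V3), t • y) = _
    rw [smul_zero, hL, inner_zero_right, zero_add, real_inner_smul_left, real_inner_smul_right]
  rw [← ht, norm_dual_eq_norm_of_inner e1, norm_dual_eq_norm_of_inner e2,
    norm_dual_eq_norm_of_inner f1, norm_dual_eq_norm_of_inner f2]
  have hn2 : ‖n‖ ^ 2 ≠ 0 := pow_ne_zero 2 (norm_ne_zero_iff.2 hn)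
  have hl' : l * ‖n‖ ^ 2 = ⟪a, n⟫ - ⟪b, n⟫ := by
    rw [hl, ← inner_sub_left, div_mul_cancel₀ _ hn2]
  rw [norm_smul, norm_smul, norm_smul, norm_smul, mul_pow, mul_pow, mul_pow, mul_pow,
    norm_sub_sq_real, norm_add_sq_real, inner_smul_right, inner_smul_right, norm_smul, mul_pow,
    Real.norm_eq_abs, Real.norm_eq_abs, sq_abs, sq_abs]
  linear_combination (2 * t ^ 2 * l) * hl'

/-- **The elastic reflection preserves the Maxwellian pair law** `M_{θ,u} ⊗ M_{θ,u}` (for every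
impact direction `n`; an isometry of `ℝ³ ⊕ ℝ³` fixing the diagonal drift). [folklore] -/
theorem map_reflectVel_maxwellianPair (θ : ℝ) (n u : V3) :
    (((stdGaussian V3).map (fun ξ => u + Real.sqrt θ • ξ)).prod
        ((stdGaussian V3).map (fun ξ => u + Real.sqrt θ • ξ))).map (reflectVel n) =
      ((stdGaussian V3).map (fun ξ => u + Real.sqrt θ • ξ)).prod
        ((stdGaussian V3).map (fun ξ => u + Real.sqrt θ • ξ)) := by
  by_cases hn : n = 0
  · subst hn
    rw [show (reflectVel (0 : V3) : V3 × V3 → V3 × V3) = id from funext reflectVel_zero]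
    exact Measure.map_id
  obtain ⟨A, hA⟩ := exists_clm_reflectVel θ n u
  have hf : Measurable (fun ξ : V3 => u + Real.sqrt θ • ξ) := by fun_prop
  have hMM : ((stdGaussian V3).map (fun ξ => u + Real.sqrt θ • ξ)).prod
        ((stdGaussian V3).map (fun ξ => u + Real.sqrt θ • ξ)) =
      ((stdGaussian V3).prod (stdGaussian V3)).map
        (fun p => (Real.sqrt θ • ContinuousLinearMap.id ℝ (V3 × V3)) p + (u, u)) := by
    rw [Measure.map_prod_map _ _ hf hf]
    congr 1
    funext p
    obtain ⟨x, y⟩ := p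
    change (u + Real.sqrt θ • x, u + Real.sqrt θ • y) = (Real.sqrt θ • x, Real.sqrt θ • y) + (u, u)
    rw [Prod.mk_add_mk, add_comm u, add_comm u]
  have hK : (((stdGaussian V3).map (fun ξ => u + Real.sqrt θ • ξ)).prod
        ((stdGaussian V3).map (fun ξ => u + Real.sqrt θ • ξ))).map (reflectVel n) =
      ((stdGaussian V3).prod (stdGaussian V3)).map (fun p => A p + (u, u)) := by
    rw [Measure.map_prod_map _ _ hf hf,
      Measure.map_map (continuous_reflectVel n).measurable (hf.prodMap hf)]
    congr 1
    funext p
    obtain ⟨x, y⟩ := p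
    simp [Prod.map, hA]
  rw [hK, hMM]
  exact map_stdGaussian₂_eq_map_stdGaussian₂ (reflectVel_variance_identity θ hn u hA) (u, u)

/-- The full contact-Langevin collision kernel is the tangential kick applied after the elastic
reflection: `K ∘ μ = K_t ∘ (R_* μ)`. [cite: ChapmanCowling1970, §11.2 eq. 7] -/
theorem clKernel_comp_eq_clTangentialKernel_comp_map (κ θb : ℝ) (n : V3) (μ : Measure (V3 × V3))
    [SFinite μ] :
    clKernel κ θb n ∘ₘ μ = clTangentialKernel κ θb n ∘ₘ μ.map (reflectVel n) := by
  rw [clKernel_comp_eq_map, clTangentialKernel_comp_eq_map,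
    map_prod_eq_map_prodMap_id _ _ (continuous_reflectVel n).measurable,
    Measure.map_map (measurable_clTangentialKick κ θb n)
      ((continuous_reflectVel n).measurable.prodMap measurable_id)]
  congr 1
  funext q
  simp [Prod.map, clKick_eq_clTangentialKick_reflectVel]

/-- **Matched-temperature invariance of the full contact-Langevin collision kernel**: for
`κ ≥ 0`, `θ ≥ 0`, `n ≠ 0` and any drift `u`, the Maxwellian pair law `M_{θ,u} ⊗ M_{θ,u}` is
invariant under `clKernel κ θ n` (elastic reflection followed by the Gaussian tangential kick at
bath temperature `θ`) — the pair-level statement that Gibbs(`θ`) is stationary for the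
spin-marginalised Bryan–Pidduck rule with the spins drawn from Gibbs(`θ`)
(Chapman–Cowling 1970, (11.2,7)). [folklore] -/
theorem clKernel_invariant_maxwellianPair {κ θ : ℝ} (hκ : 0 ≤ κ) (hθ : 0 ≤ θ) {n : V3}
    (hn : n ≠ 0) (u : V3) :
    Kernel.Invariant (clKernel κ θ n)
      (((stdGaussian V3).map (fun ξ => u + Real.sqrt θ • ξ)).prod
        ((stdGaussian V3).map (fun ξ => u + Real.sqrt θ • ξ))) := by
  rw [Kernel.Invariant, clKernel_comp_eq_clTangentialKernel_comp_map,
    map_reflectVel_maxwellianPair]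
  exact clTangentialKernel_invariant_maxwellianPair hκ hθ hn u

/-! ### Density form: the local Maxwellian law `M_{1,u,θ}(v) dv` -/

section Density

variable {E : Type*} [NormedAddCommGroup E] [InnerProductSpace ℝ E] [FiniteDimensional ℝ E]
  [MeasurableSpace E] [BorelSpace E]

/-- The unit-density local Maxwellian law `M_{1,u,θ}(v) dv = (2πθ)^{-d/2} e^{-|v-u|²/(2θ)} dv`
(`Literature.Analysis.FluidPDE.localMaxwellian`) is, for `θ > 0`, the law of `u + √θ ξ` with
`ξ ~ N(0, I_d)` (`stdGaussian E`): change of variables in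
`stdGaussian_eq_withDensity_globalMaxwellian`. [folklore] -/
theorem withDensity_localMaxwellian_eq_map_stdGaussian {θ : ℝ} (hθ : 0 < θ) (u : E) :
    (volume : Measure E).withDensity (fun v => ENNReal.ofReal (localMaxwellian 1 θ u v)) =
      (stdGaussian E).map (fun ξ => u + Real.sqrt θ • ξ) := by
  obtain ⟨c, hc⟩ : ∃ c : ℝ, c = Real.sqrt θ := ⟨_, rfl⟩
  have hc0 : 0 < c := by rw [hc]; exact Real.sqrt_pos.2 hθ
  have hφ : Measurable (fun ξ : E => u + c • ξ) := by fun_prop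
  have hlm : Measurable fun v : E => ENNReal.ofReal (localMaxwellian 1 θ u v) := by
    unfold localMaxwellian
    fun_prop
  -- Lebesgue measure under the affine map `ξ ↦ u + c ξ`
  have hvol : (volume : Measure E) =
      ENNReal.ofReal (|c ^ Module.finrank ℝ E|) •
        (volume : Measure E).map (fun ξ : E => u + c • ξ) := by
    have hcomp : (fun ξ : E => u + c • ξ) = (fun v => u + v) ∘ (fun ξ : E => c • ξ) := rfl
    rw [hcomp, ← Measure.map_map (measurable_const_add u) (measurable_const_smul c),
      Measure.map_addHaar_smul _ hc0.ne', Measure.map_smul, map_add_left_eq_self, smul_smul,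
      ← ENNReal.ofReal_mul (abs_nonneg _), abs_inv,
      mul_inv_cancel₀ (abs_pos.2 (pow_ne_zero _ hc0.ne')).ne', ENNReal.ofReal_one, one_smul]
  -- the pointwise identity `|c^d| M_{1,u,θ}(u + c ξ) = M(ξ)`
  have hpt : ∀ ξ : E, |c ^ Module.finrank ℝ E| * localMaxwellian 1 θ u (u + c • ξ) =
      globalMaxwellian ξ := by
    intro ξ
    have h1 : -‖u + c • ξ - u‖ ^ 2 / (2 * θ) = -‖ξ‖ ^ 2 / 2 := by
      rw [add_sub_cancel_left, norm_smul, mul_pow, Real.norm_eq_abs, sq_abs, hc,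
        Real.sq_sqrt hθ.le]
      field_simp
    have h2 : |c ^ Module.finrank ℝ E| * (2 * Real.pi * θ) ^ (-(Module.finrank ℝ E : ℝ) / 2) =
        (2 * Real.pi) ^ (-(Module.finrank ℝ E : ℝ) / 2) := by
      rw [abs_of_pos (pow_pos hc0 _), Real.mul_rpow (by positivity) hθ.le, hc,
        Real.sqrt_eq_rpow, ← Real.rpow_natCast, ← Real.rpow_mul hθ.le,
        mul_comm ((2 * Real.pi) ^ _), ← mul_assoc, ← Real.rpow_add hθ,
        show (1 / 2 : ℝ) * (Module.finrank ℝ E : ℕ) + -(Module.finrank ℝ E : ℝ) / 2 = 0 by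
          ring,
        Real.rpow_zero, one_mul]
    rw [localMaxwellian, globalMaxwellian, h1, one_mul, ← mul_assoc, h2]
  rw [← hc, stdGaussian_eq_withDensity_globalMaxwellian_holds]
  ext s hs
  rw [Measure.map_apply hφ hs, withDensity_apply _ (hφ hs), withDensity_apply _ hs]
  conv_lhs => rw [hvol]
  rw [Measure.restrict_smul, lintegral_smul_measure, smul_eq_mul, setLIntegral_map hs hlm hφ]
  have hf' : Measurable fun x : E => ENNReal.ofReal (localMaxwellian 1 θ u (u + c • x)) :=
    hlm.comp hφ
  rw [← lintegral_const_mul _ hf']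
  refine setLIntegral_congr_fun (hφ hs) fun ξ _ => ?_
  rw [← ENNReal.ofReal_mul (abs_nonneg _), hpt]

end Density

/-- `clTangentialKernel_invariant_maxwellianPair` in density form: for `θ > 0` the pair law
`M_{1,u,θ}(v) dv ⊗ M_{1,u,θ}(w) dw` is invariant under the Gaussian tangential contact kick at
bath temperature `θ`. [folklore] -/
theorem clTangentialKernel_invariant_localMaxwellianPair {κ θ : ℝ} (hκ : 0 ≤ κ) (hθ : 0 < θ)
    {n : V3} (hn : n ≠ 0) (u : V3) :
    Kernel.Invariant (clTangentialKernel κ θ n)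
      (((volume : Measure V3).withDensity fun v => ENNReal.ofReal (localMaxwellian 1 θ u v)).prod
        ((volume : Measure V3).withDensity fun v => ENNReal.ofReal (localMaxwellian 1 θ u v))) := by
  rw [withDensity_localMaxwellian_eq_map_stdGaussian hθ]
  exact clTangentialKernel_invariant_maxwellianPair hκ hθ.le hn u

/-- `clKernel_invariant_maxwellianPair` in density form: for `θ > 0` the pair law
`M_{1,u,θ}(v) dv ⊗ M_{1,u,θ}(w) dw` is invariant under the full contact-Langevin collision kernel
at bath temperature `θ` (the velocity factor of the hard-sphere Gibbs state `g_(z,β,u)`,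
`θ = β⁻¹`, `maxwellianBeta β (v - u) = localMaxwellian 1 β⁻¹ 0 (v - u)`). [folklore] -/
theorem clKernel_invariant_localMaxwellianPair {κ θ : ℝ} (hκ : 0 ≤ κ) (hθ : 0 < θ) {n : V3}
    (hn : n ≠ 0) (u : V3) :
    Kernel.Invariant (clKernel κ θ n)
      (((volume : Measure V3).withDensity fun v => ENNReal.ofReal (localMaxwellian 1 θ u v)).prod
        ((volume : Measure V3).withDensity fun v => ENNReal.ofReal (localMaxwellian 1 θ u v))) := by
  rw [withDensity_localMaxwellian_eq_map_stdGaussian hθ]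
  exact clKernel_invariant_maxwellianPair hκ hθ.le hn u

end Literature.MathematicalPhysics.KineticTheory

end
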